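import Summits.AtomisticToContinuum.BoseEinsteinCondensation.Theses.BECConjugateDomination
import Literature.MathematicalPhysics.QuantumManyBody.PeriodicBoseGasFourier
import Mathlib.Analysis.Calculus.FDeriv.Basic
import HarnessLib

/-!
# Route `BECConjugateDomination`, crux `InfraredMinimumUncertainty` (stmt-AtomisticToContinuum-11784):
# vocabulary of the line `fisher-gaussian-density-mode`

Route-posited objects (D-0016 `<Route>Defs` file) shared by the registered stubs of the skeleton
`Cruxes/InfraredMinimumUncertainty/Lines/fisher-gaussian-density-mode.lean` and by the crux file
that composes them. Nothing is asserted: every `def … : Prop` below is a *statement* (the two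
registered stub signatures and the two hypothesis bundles of the crux), consumed only as the type
of a stub theorem or as an explicit hypothesis.

Objects (bodies are the crux's `let`s verbatim, over the torus vocabulary of
`PeriodicBoseGas.lean` / `PeriodicBoseGasFourier.lean`; units `ħ = 2m = 1`):

* `InSmoothClass v` — the smooth potential class of the route (the four curried hypotheses of the
  crux on `v`: repulsive finite range, finite, `C²` as `x ↦ v(|x|)`, edge condition `‖D²ṽ‖ ≤ Cₑ√ṽ`);
* `IsPositiveMinimiser v Ψ` — the four standing hypotheses of the crux on the state
  (`periodicEnergy = E₀^per`, finite, `Ψ = |Ψ|` and `Ψ ≠ 0` pointwise);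
* `densityMode N L m X = Z_m(X) = ∑ⱼ e_m(xⱼ) ∈ ℂ` — the density mode (collective coordinate
  `ρ_k`, `k = 2πm/L`);
* `coherence n L Ψ r = g(r) = ∫_cell dx ∫_{cell^n} dY |Ψ(x+r,Y)| |Ψ(x,Y)|` — the translation-averaged
  one-body coherence (`ρ⁻¹ ×` the averaged one-body density matrix, `g(0) = 1`);
* `levyWeight n L Ψ m = ν_m = Re ĉ_m(log g)` — the Lévy (phase) weight [MoraCastin2003 §4.3 for the
  `log g₁` bookkeeping at Bogoliubov order];
* `structureFactor n L Ψ m = S_m = N⁻¹ ∫ |Z_m|² |Ψ|²` — the (uncentred) static structure factor;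
* `planarDiv φ z = ∂ₓ Re φ + ∂_y Im φ` — divergence of a vector field on `ℂ ≅ ℝ²`;
* `fisherTest n L Ψ m φ = J(φ) = −2 E[(div φ)(Z_m)] − E[|φ(Z_m)|²]` under `|Ψ|² dX` — the Fisher
  TEST functional of the law `μ_Z` of the density mode: `sup_φ J(φ) = I(μ_Z)` (trace Fisher
  information; `+∞` iff `μ_Z` has no finite-information density), so "`∃ φ, a ≤ C·J(φ)`" renders
  `a ≤ C·I(μ_Z)` and "`∀ φ, J(φ)·b ≤ C`" renders `I(μ_Z)·b ≤ C` with no supremum and no density;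
* `FisherDomination` (FD, registered stub `stub_fisherDomination`): `∃ φ ∈ C¹, 16 ν_m ≤ C·J(φ)`;
* `FisherGaussianity` (FG, registered stub `stub_fisherGaussianity`): `∀ φ ∈ C¹, J(φ)·(N S_m) ≤ C'`.

Small API: `norm_densityMode_le` (`|Z_m| ≤ N`), `mul_structureFactor_nonneg` (`N S_m ≥ 0`),
`mul_structureFactor_eq` (`N S_m = E|Z_m|²`). (The Bochner normalisation `∫_{cell^N}|Ψ|² = 1` is
`Theorems.StaticResponseBound.Negative.integral_norm_sq_eq_one`, reused, not restated.)

The registered bookkeeping stub `stub_imuOfParts : FisherDomination → FisherGaussianity →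
InfraredMinimumUncertainty` (the composition of the line, constants `C = C₁C₂/16`,
`ρ₀ = min ρ₁ ρ₂`; its first step `change`s the crux's `let`-bound goal into the named objects, which
certifies that the bodies above ARE the crux's `let`s) is proved at the end; through it this
vocabulary file lands as a `--supports` file of stmt-AtomisticToContinuum-11784 (precedent:
`FKParityRobustnessDefs.lean` / `stub_massSplit`).

References: the line card `Cruxes/InfraredMinimumUncertainty/Lines/fisher-gaussian-density-mode.md`;
L. Pitaevskii, S. Stringari, J. Low Temp. Phys. 85 (1991) 377 / Stringari 1995 §2.2 (9)–(11) (the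
reverse, `n₀`-carrying uncertainty inequality); C. Mora, Y. Castin, Phys. Rev. A 67 (2003) 053615
§4.3 (Lévy weight of `log g₁`); A. J. Stam, Inform. Control 2 (1959) 101 and N. M. Blachman, IEEE
Trans. IT 11 (1965) 267 (Fisher information, variational form and convolution inequality).
-/

noncomputable section

open MeasureTheory Filter Set Metric
open scoped ENNReal NNReal Topology ComplexConjugate BigOperators

namespace Summit.AtomisticToContinuum.BoseEinsteinCondensation.Cruxes.InfraredMinimumUncertainty.FisherGaussianDensityMode

open Literature.MathematicalPhysics.QuantumManyBody.BoseGas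

/-! ## The hypothesis bundles of the crux -/

/-- The smooth potential class of route `BECConjugateDomination` (repulsive, finite range, finite,
`C²` as `ṽ(x) = v(|x|)`, edge condition `‖D²ṽ‖ ≤ Cₑ √ṽ`) — the four curried hypotheses of the crux
`InfraredMinimumUncertainty` on the potential, bundled. -/
def InSmoothClass (v : ℝ → ℝ≥0∞) : Prop :=
  IsRepulsiveFiniteRange v ∧ (∀ r, v r ≠ ⊤) ∧ ContDiff ℝ 2 (fun x : Space => (v ‖x‖).toReal) ∧
    ∃ Cₑ : ℝ, ∀ x : Space,
      ‖iteratedFDeriv ℝ 2 (fun x : Space => (v ‖x‖).toReal) x‖ ≤ Cₑ * Real.sqrt ((v ‖x‖).toReal)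

/-- "`Ψ` is a positive minimiser": the four standing hypotheses of the crux
`InfraredMinimumUncertainty` on the state (`periodicEnergy = E₀^per`, finite energy, `Ψ = |Ψ|`
pointwise, `Ψ ≠ 0` pointwise). -/
def IsPositiveMinimiser (v : ℝ → ℝ≥0∞) {n : ℕ} {L : ℝ} (Ψ : PeriodicTrialState (n + 1) L) : Prop :=
  periodicEnergy v Ψ = periodicGroundStateEnergy v (n + 1) L ∧ periodicEnergy v Ψ ≠ ⊤ ∧
    (∀ X, Ψ.ψ X = (‖Ψ.ψ X‖ : ℂ)) ∧ (∀ X, Ψ.ψ X ≠ 0)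

/-! ## The objects of the crux, named (bodies are the crux's `let`s verbatim) -/

/-- The density mode (collective coordinate) `Z_m(X) = ∑ⱼ e_m(xⱼ) ∈ ℂ`, `e_m(x) = e^{2πi m·x/L}`
(the Fourier component `ρ_k`, `k = 2πm/L`, of the empirical density). -/
def densityMode (N : ℕ) (L : ℝ) (m : Fin 3 → ℤ) (X : Config N) : ℂ :=
  ∑ j : Fin N, cellWave L m (X j)

/-- The translation-averaged one-body coherence
`g(r) = ∫_cell dx ∫_{cell^n} dY |Ψ(x+r,Y)| |Ψ(x,Y)|` (`= ρ⁻¹ ×` the translation-averaged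
one-body density matrix for `Ψ ≥ 0`; `g(0) = 1`). The crux's `let g`. -/
def coherence (n : ℕ) (L : ℝ) (Ψ : PeriodicTrialState (n + 1) L) (r : Space) : ℝ :=
  ∫ x in cell L, ∫ Y in cellN n L, ‖Ψ.ψ (Matrix.vecCons (x + r) Y)‖ * ‖Ψ.ψ (Matrix.vecCons x Y)‖

/-- The Lévy weight `ν_m = Re ĉ_m(log g)` of the coherence (cell Fourier coefficient of `log g`).
The crux's `let ν`. -/
def levyWeight (n : ℕ) (L : ℝ) (Ψ : PeriodicTrialState (n + 1) L) (m : Fin 3 → ℤ) : ℝ :=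
  (cellFourierCoeff L (fun r : Space => ((Real.log (coherence n L Ψ r) : ℝ) : ℂ)) m).re

/-- The (uncentred) static structure factor `S_m = N⁻¹ ∫_{cell^N} |Z_m|² |Ψ|²`. The crux's
`let S`. -/
def structureFactor (n : ℕ) (L : ℝ) (Ψ : PeriodicTrialState (n + 1) L) (m : Fin 3 → ℤ) : ℝ :=
  ((n : ℝ) + 1)⁻¹ * ∫ X in cellN (n + 1) L, ‖∑ j : Fin (n + 1), cellWave L m (X j)‖ ^ 2 * ‖Ψ.ψ X‖ ^ 2

/-! ## The Fisher test functional of the law of the density mode -/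

/-- Planar divergence of a vector field `φ : ℂ → ℂ` (`ℂ ≅ ℝ²` as a real normed space):
`div φ = ∂ₓ Re φ + ∂_y Im φ = Re (Dφ·1) + Im (Dφ·i)` (`0` where `φ` is not differentiable). -/
def planarDiv (φ : ℂ → ℂ) (z : ℂ) : ℝ :=
  (fderiv ℝ φ z 1).re + (fderiv ℝ φ z Complex.I).im

/-- The **Fisher test functional** of the law `μ_Z` of the density mode `Z_m` under `|Ψ|² dX`
(on the fundamental cell), at the test field `φ`:  `J(φ) = −2 E[(div φ)(Z_m)] − E[|φ(Z_m)|²]`.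
If `μ_Z = f dz` with `∫ |∇f|²/f < ∞` then `−E[div φ (Z)] = E[∇ log f(Z) · φ(Z)]`, so
`J(φ) = I(μ_Z) − E|φ(Z) − ∇ log f(Z)|² ≤ I(μ_Z)` with `sup_φ J = I(μ_Z)` (the variational form of
the Fisher information); if `μ_Z` has no such density, `sup_φ J = +∞`. -/
def fisherTest (n : ℕ) (L : ℝ) (Ψ : PeriodicTrialState (n + 1) L) (m : Fin 3 → ℤ) (φ : ℂ → ℂ) : ℝ :=
  -2 * (∫ X in cellN (n + 1) L, planarDiv φ (densityMode (n + 1) L m X) * ‖Ψ.ψ X‖ ^ 2) -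
    ∫ X in cellN (n + 1) L, ‖φ (densityMode (n + 1) L m X)‖ ^ 2 * ‖Ψ.ψ X‖ ^ 2

/-! ## The two registered stub statements of the line -/

/-- `FisherDomination` (FD, the signature of the registered stub `stub_fisherDomination`; the
load-bearing infrared inequality in Fisher form): for every smooth-class `v` there are `C ≥ 0`,
`ρ₀ > 0` such that for `0 < ρ < ρ₀`, all large `N = n+1`, every positive minimiser `Ψ` on the torus
of side `(N/ρ)^{1/3}` and every `m ≠ 0` there is a `C¹` test field `φ : ℂ → ℂ` with
`16 ν_m ≤ C · J_{Ψ,m}(φ)`; i.e. `16 ν_m ≤ C · I(law of Z_m under Ψ²)`. Necessary for the crux: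
IMU(C₀) ⇒ FD(4C₀ + 4) by the cut-off linear field (planar Cramér–Rao). A statement, not a fact. -/
def FisherDomination : Prop :=
  ∀ v : ℝ → ℝ≥0∞, InSmoothClass v → ∃ C : ℝ, 0 ≤ C ∧ ∃ ρ₀ : ℝ, 0 < ρ₀ ∧ ∀ ρ : ℝ, 0 < ρ → ρ < ρ₀ →
    ∀ᶠ n : ℕ in atTop, ∀ Ψ : PeriodicTrialState (n + 1) (sideLength ρ (n + 1)),
      IsPositiveMinimiser v Ψ → ∀ m : Fin 3 → ℤ, m ≠ 0 →
        ∃ φ : ℂ → ℂ, ContDiff ℝ 1 φ ∧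
          16 * levyWeight n (sideLength ρ (n + 1)) Ψ m ≤ C * fisherTest n (sideLength ρ (n + 1)) Ψ m φ

/-- `FisherGaussianity` (FG, the signature of the registered stub `stub_fisherGaussianity`;
Fisher-Gaussianity of the density mode at its own scale): for every smooth-class `v` there are
`C' ≥ 0`, `ρ₀ > 0` such that for `0 < ρ < ρ₀`, all large `N`, every positive minimiser `Ψ`, every
`m ≠ 0` and EVERY `C¹` test field `φ`: `J_{Ψ,m}(φ) · (N S_m) ≤ C'`; i.e. `I(μ_{Z_m}) · E|Z_m|² ≤ C'`
(`= 4` for a centred isotropic complex Gaussian; at `v ≡ 0` it is the Fisher-information CLT for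
Kluyver sums of `N` i.i.d. unit phasors). A statement, not a fact. -/
def FisherGaussianity : Prop :=
  ∀ v : ℝ → ℝ≥0∞, InSmoothClass v → ∃ C : ℝ, 0 ≤ C ∧ ∃ ρ₀ : ℝ, 0 < ρ₀ ∧ ∀ ρ : ℝ, 0 < ρ → ρ < ρ₀ →
    ∀ᶠ n : ℕ in atTop, ∀ Ψ : PeriodicTrialState (n + 1) (sideLength ρ (n + 1)),
      IsPositiveMinimiser v Ψ → ∀ m : Fin 3 → ℤ, m ≠ 0 →
        ∀ φ : ℂ → ℂ, ContDiff ℝ 1 φ →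
          fisherTest n (sideLength ρ (n + 1)) Ψ m φ *
              (((n : ℝ) + 1) * structureFactor n (sideLength ρ (n + 1)) Ψ m) ≤ C

/-! ## Small API -/

/-- `|Z_m(X)| ≤ N` (a sum of `N` unimodular terms). -/
theorem norm_densityMode_le (N : ℕ) (L : ℝ) (m : Fin 3 → ℤ) (X : Config N) :
    ‖densityMode N L m X‖ ≤ N := by
  unfold densityMode
  calc ‖∑ j : Fin N, cellWave L m (X j)‖ ≤ ∑ j : Fin N, ‖cellWave L m (X j)‖ := norm_sum_le _ _
    _ = N := by simp [norm_cellWave]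

/-- `N · S_m ≥ 0`. -/
theorem mul_structureFactor_nonneg (n : ℕ) (L : ℝ) (Ψ : PeriodicTrialState (n + 1) L)
    (m : Fin 3 → ℤ) : 0 ≤ ((n : ℝ) + 1) * structureFactor n L Ψ m := by
  unfold structureFactor
  have hI : 0 ≤ ∫ X in cellN (n + 1) L, ‖∑ j : Fin (n + 1), cellWave L m (X j)‖ ^ 2 * ‖Ψ.ψ X‖ ^ 2 :=
    integral_nonneg fun X => by positivity
  positivity

/-- `N · S_m = E|Z_m|² = ∫_{cell^N} |Z_m|² |Ψ|²`. -/
theorem mul_structureFactor_eq (n : ℕ) (L : ℝ) (Ψ : PeriodicTrialState (n + 1) L)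
    (m : Fin 3 → ℤ) : ((n : ℝ) + 1) * structureFactor n L Ψ m =
      ∫ X in cellN (n + 1) L, ‖densityMode (n + 1) L m X‖ ^ 2 * ‖Ψ.ψ X‖ ^ 2 := by
  unfold structureFactor densityMode
  rw [← mul_assoc, mul_inv_cancel₀ (by positivity), one_mul]

/-! ## The registered bookkeeping stub: FD ∧ FG ⇒ IMU -/

open Summit.AtomisticToContinuum.BoseEinsteinCondensation.Theses.BECConjugateDomination
  (InfraredMinimumUncertainty) in
/-- **Registered stub `stub_imuOfParts` (bookkeeping, closed): FD ∧ FG ⇒ IMU, constants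
tracked.** From `16 ν_m ≤ C₁ J(φ)` (FD's witness `φ`) and `J(φ)·(N S_m) ≤ C₂` (FG at that `φ`),
`16 ν_m (N S_m) ≤ C₁ J(φ) (N S_m) ≤ C₁ C₂` since `N S_m ≥ 0`; so the crux
`InfraredMinimumUncertainty` of route `BECConjugateDomination` (stmt-AtomisticToContinuum-11784)
holds with `C = C₁ C₂ / 16` and `ρ₀ = min ρ₁ ρ₂`. The `change` step is the certificate that
`levyWeight` / `structureFactor` are the crux's `let ν` / `let S` verbatim. -/
theorem stub_imuOfParts : FisherDomination → FisherGaussianity → InfraredMinimumUncertainty := by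
  intro hFD hFG v hv₁ hv₂ hv₃ hv₄
  obtain ⟨C₁, hC₁, ρ₁, hρ₁, h₁⟩ := hFD v ⟨hv₁, hv₂, hv₃, hv₄⟩
  obtain ⟨C₂, hC₂, ρ₂, hρ₂, h₂⟩ := hFG v ⟨hv₁, hv₂, hv₃, hv₄⟩
  refine ⟨C₁ * C₂ / 16, by positivity, min ρ₁ ρ₂, lt_min hρ₁ hρ₂, fun ρ hρ hρ₀ => ?_⟩
  filter_upwards [h₁ ρ hρ (lt_of_lt_of_le hρ₀ (min_le_left _ _)),
    h₂ ρ hρ (lt_of_lt_of_le hρ₀ (min_le_right _ _))] with n hn₁ hn₂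
  -- the crux's four `let`s (L, g, ν, S) are introduced as local definitions, then its hypotheses
  intro Ψ L g ν S hE hfin hreal hpos m hm
  change ((n : ℝ) + 1) * levyWeight n (sideLength ρ (n + 1)) Ψ m *
      structureFactor n (sideLength ρ (n + 1)) Ψ m ≤ C₁ * C₂ / 16
  obtain ⟨φ, hφ, hFDm⟩ := hn₁ Ψ ⟨hE, hfin, hreal, hpos⟩ m hm
  have hFGm := hn₂ Ψ ⟨hE, hfin, hreal, hpos⟩ m hm φ hφ
  have hNS := mul_structureFactor_nonneg n (sideLength ρ (n + 1)) Ψ m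
  have key : 16 * levyWeight n (sideLength ρ (n + 1)) Ψ m *
      (((n : ℝ) + 1) * structureFactor n (sideLength ρ (n + 1)) Ψ m) ≤ C₁ * C₂ :=
    calc 16 * levyWeight n (sideLength ρ (n + 1)) Ψ m *
          (((n : ℝ) + 1) * structureFactor n (sideLength ρ (n + 1)) Ψ m)
        ≤ C₁ * fisherTest n (sideLength ρ (n + 1)) Ψ m φ *
          (((n : ℝ) + 1) * structureFactor n (sideLength ρ (n + 1)) Ψ m) :=
          mul_le_mul_of_nonneg_right hFDm hNS
      _ = C₁ * (fisherTest n (sideLength ρ (n + 1)) Ψ m φ *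
          (((n : ℝ) + 1) * structureFactor n (sideLength ρ (n + 1)) Ψ m)) := by ring
      _ ≤ C₁ * C₂ := mul_le_mul_of_nonneg_left hFGm hC₁
  nlinarith [key]

/-!
# Appendix (gen 2 of the line, 2026-08-16): the lifted Fisher test functional and the conjugate-proxy ladder

Route-posited objects of the gen-2 skeleton `Cruxes/InfraredMinimumUncertainty/Lines/fisher-gaussian-density-mode.lean`
(crux-plan gen 2), appended to the gen-1 vocabulary above (which stays byte-identical; `densityMode`,
`coherence`, `levyWeight`, `structureFactor`, `mul_structureFactor_nonneg` are SHARED, not re-declared).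
Nothing is asserted: every `def … : Prop` below is a *statement* (registered stub signatures of the
gen-2 skeleton, its typed fallback cuts, and the crux restated over the named objects), consumed only
as the type of a stub theorem, as an explicit hypothesis of a glue lemma, or (for
`InfraredMinimumUncertaintyNamed`) certified equal to the route decl by `Iff.rfl`.

* `waveVec L m = k = (2π/L) • m ∈ ℝ³`;
* `commutatorAmp N L ψ m X = W_m(X) = ([H, ρ_k]Ψ)(X) = ∑ⱼ e_m(xⱼ)(‖k‖² Ψ(X) − 2i ∂_{xⱼ·k}Ψ(X))`
  (first derivatives of the `C¹` amplitude only);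
* `secondMoment N L ψ m = m₂ = ∫_{cell^N} |W_m|²` (`= ‖[H,ρ_k]Ψ‖²` for a normalised state);
* `fisherTestV n L Ψ m φ = J_m(φ) = −(4/(N‖k‖²)) Re∫ φ̄(Z_m) W_m Ψ̄ − ∫ |φ(Z_m)|²|Ψ|²`, the LIFTED Fisher
  test functional (`sup_φ J_m = E|E[σ | Z_m]|²`, `σ = −2W/(N‖k‖²Ψ)` the score of `Ψ²` along the
  density-wave lift; finite at every `N`, unlike the planar-divergence functional `fisherTest` above);
* `CruxFrame P` (the crux's quantifier frame around `P C ρ n Ψ`), `FisherDominationV` (FD, registered stub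
  `stub_phaseFisherDomination`), `FisherGaussianityV` (FG, registered stub `stub_densityFisherGaussianity`),
  the typed fallback cuts `DensityMomentDomination`/`FeynmanSaturation`/`SecondMomentBound`/`StructureFactorCeiling`,
  and `InfraredMinimumUncertaintyNamed` (the crux over the named objects, `… ↔ InfraredMinimumUncertainty := Iff.rfl`).

References: the gen-2 line card `Lines/fisher-gaussian-density-mode.md`; Feynman, Phys. Rev. 94 (1954) 262;
Puff, Phys. Rev. 137 (1965) A406; Stringari 1995 §2.2–2.3; Stam, Inform. Control 2 (1959) 101.
-/

open Summit.AtomisticToContinuum.BoseEinsteinCondensation.Theses.BECConjugateDomination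
  (InfraredMinimumUncertainty)

/-! ## Gen-2 objects -/

/-- The wave vector `k = 2π m / L ∈ ℝ³` of the mode `m ∈ ℤ³` (`‖k‖ = kn m` of `PuffFloor`). -/
def waveVec (L : ℝ) (m : Fin 3 → ℤ) : Space :=
  (2 * Real.pi / L) • latticeVec 1 m

/-- The **commutator amplitude** `W_m(X) = ([H, ρ_k]Ψ)(X) = ∑ⱼ e_m(xⱼ) (‖k‖² Ψ(X) − 2i ∂_{xⱼ·k}Ψ(X))`
(`H = −∑Δⱼ + V`; the potential commutes with `ρ_k = Z_m`; `[−Δⱼ, e^{ik·xⱼ}] = e^{ik·xⱼ}(‖k‖² − 2ik·∇ⱼ)`).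
Only FIRST derivatives of the `C¹` amplitude enter (no junk for any trial state). For the ground state
`W_m = (H − E₀)(Z_m Ψ)`. -/
def commutatorAmp (N : ℕ) (L : ℝ) (ψ : Config N → ℂ) (m : Fin 3 → ℤ) (X : Config N) : ℂ :=
  ∑ j : Fin N, cellWave L m (X j) *
    (((‖waveVec L m‖ ^ 2 : ℝ) : ℂ) * ψ X - 2 * Complex.I * fderiv ℝ ψ X (Pi.single j (waveVec L m)))

/-- The second energy-weighted moment of the density response, `m₂ = ‖[H, ρ_k]Ψ‖² = ∫_{cell^N} |W_m|²`
(for a normalised state; f-sum `m₁ = N‖k‖²`, `m₀ = N S_m`). Bogoliubov: `m₂ = N‖k‖³ √(‖k‖² + 16πρa)`;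
free gas: `m₂ = N‖k‖⁴`. -/
def secondMoment (N : ℕ) (L : ℝ) (ψ : Config N → ℂ) (m : Fin 3 → ℤ) : ℝ :=
  ∫ X in cellN N L, ‖commutatorAmp N L ψ m X‖ ^ 2

/-- The **lifted Fisher test functional** of the density mode `Z_m` under `|Ψ|² dX`, at the test field
`φ : ℂ → ℂ`:
`J_m(φ) = −(4/(N‖k‖²)) Re ∫ φ̄(Z_m) W_m Ψ̄ dX − ∫ |φ(Z_m)|² |Ψ|² dX = 2E[Re(φ̄(Z)σ)] − E|φ(Z)|²`
with `σ = −2W/(N‖k‖²Ψ)` the score of `Ψ²` along the density-wave lift. Pointwise AM–GM gives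
`J_m(φ) ≤ E|σ|² = 4m₂/(N²‖k‖⁴)` for EVERY `φ`, and `sup_φ J_m = E|E[σ|Z]|²`: "`∃ φ, a ≤ C·J(φ)`" renders
`a ≤ C·I^V(Z_m)`, "`∀ φ, J(φ)·b ≤ C`" renders `I^V(Z_m)·b ≤ C` — no supremum, no density, finite at
every `N`. [Stam 1959 (variational form of the Fisher information); the lift is this line's] -/
def fisherTestV (n : ℕ) (L : ℝ) (Ψ : PeriodicTrialState (n + 1) L) (m : Fin 3 → ℤ) (φ : ℂ → ℂ) : ℝ :=
  -(4 / (((n : ℝ) + 1) * ‖waveVec L m‖ ^ 2)) *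
      (∫ X in cellN (n + 1) L, (starRingEnd ℂ (φ (densityMode (n + 1) L m X)) *
        commutatorAmp (n + 1) L Ψ.ψ m X * starRingEnd ℂ (Ψ.ψ X)).re) -
    ∫ X in cellN (n + 1) L, ‖φ (densityMode (n + 1) L m X)‖ ^ 2 * ‖Ψ.ψ X‖ ^ 2

/-! ## The crux frame and the named statements of the ladder (statements, not facts) -/

/-- The quantifier frame of the crux: for every smooth-class `v` (repulsive finite range, finite, `C²`
as `ṽ(x) = v(|x|)`, edge condition `‖D²ṽ‖ ≤ Cₑ√ṽ`) there are `C ≥ 0`, `ρ₀ > 0` such that for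
`0 < ρ < ρ₀`, all large `N = n+1` and every positive minimiser `Ψ` on the torus of side `(N/ρ)^{1/3}`
(`periodicEnergy = E₀^per < ∞`, `Ψ = |Ψ| ≠ 0` pointwise — the crux's four curried hypotheses verbatim),
`P C ρ n Ψ`. A statement former, not a fact. -/
def CruxFrame (P : ℝ → ∀ (ρ : ℝ) (n : ℕ), PeriodicTrialState (n + 1) (sideLength ρ (n + 1)) → Prop) :
    Prop :=
  ∀ v : ℝ → ℝ≥0∞, IsRepulsiveFiniteRange v → (∀ r, v r ≠ ⊤) →
    ContDiff ℝ 2 (fun x : Space => (v ‖x‖).toReal) →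
    (∃ Cₑ : ℝ, ∀ x : Space,
      ‖iteratedFDeriv ℝ 2 (fun x : Space => (v ‖x‖).toReal) x‖ ≤ Cₑ * Real.sqrt ((v ‖x‖).toReal)) →
    ∃ C : ℝ, 0 ≤ C ∧ ∃ ρ₀ : ℝ, 0 < ρ₀ ∧ ∀ ρ : ℝ, 0 < ρ → ρ < ρ₀ → ∀ᶠ n : ℕ in atTop,
      ∀ Ψ : PeriodicTrialState (n + 1) (sideLength ρ (n + 1)),
        periodicEnergy v Ψ = periodicGroundStateEnergy v (n + 1) (sideLength ρ (n + 1)) →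
        periodicEnergy v Ψ ≠ ⊤ → (∀ X, Ψ.ψ X = (‖Ψ.ψ X‖ : ℂ)) → (∀ X, Ψ.ψ X ≠ 0) → P C ρ n Ψ

/-- **FD — Fisher domination of the Lévy weight** (the signature of the registered gen-2 stub
`stub_phaseFisherDomination`, the HARDEST; open-problem strength, NECESSARY for the crux):
`∃ φ continuous, 16 ν_m ≤ C·J_m(φ)`, i.e. `16 ν_m ≤ C · I^V(Z_m)`. Bogoliubov `C = 1` sharp as
`k → 0`; `v ≡ 0`: `ν = 0`; IMU(C₀) ⇒ FD(4C₀+4) (Cramér–Rao with the linear field); FD(C) ⇒ DMD(C).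
A statement, not a fact. -/
def FisherDominationV : Prop :=
  CruxFrame fun C ρ n Ψ => ∀ m : Fin 3 → ℤ, m ≠ 0 → ∃ φ : ℂ → ℂ, Continuous φ ∧
    16 * levyWeight n (sideLength ρ (n + 1)) Ψ m ≤ C * fisherTestV n (sideLength ρ (n + 1)) Ψ m φ

/-- **FG — Fisher-Gaussianity of the density mode** (the signature of the registered gen-2 stub
`stub_densityFisherGaussianity`, the residual): `∀ φ continuous, J_m(φ)·(N S_m) ≤ C`, i.e.
`I^V(Z_m) · E|Z_m|² ≤ C` (`= 4` exactly for the free gas at every `N` and for the Bogoliubov density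
mode; Cramér–Rao gives `≥ 4` when attained). A statement, not a fact. -/
def FisherGaussianityV : Prop :=
  CruxFrame fun C ρ n Ψ => ∀ m : Fin 3 → ℤ, m ≠ 0 → ∀ φ : ℂ → ℂ, Continuous φ →
    fisherTestV n (sideLength ρ (n + 1)) Ψ m φ *
      (((n : ℝ) + 1) * structureFactor n (sideLength ρ (n + 1)) Ψ m) ≤ C

/-- **DMD — density-moment domination** (typed fallback phase-side cut = the waypoint of the sibling card
`density-moment-domination`; WEAKER than FD, necessary for IMU): `4 N² ‖k‖⁴ ν_m ≤ C · m₂`.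
Bogoliubov `C = 1`. A statement, not a fact. -/
def DensityMomentDomination : Prop :=
  CruxFrame fun C ρ n Ψ => ∀ m : Fin 3 → ℤ, m ≠ 0 →
    4 * ((n : ℝ) + 1) ^ 2 * ‖waveVec (sideLength ρ (n + 1)) m‖ ^ 4 * levyWeight n (sideLength ρ (n + 1)) Ψ m ≤
      C * secondMoment (n + 1) (sideLength ρ (n + 1)) Ψ.ψ m

/-- **FS — Feynman single-mode saturation up to `C`** (typed fallback density-side cut, STRONGER than FG):
`(N S_m) · m₂ ≤ C · N² ‖k‖⁴`, i.e. `m₀ m₂ ≤ C m₁²` (Cauchy–Schwarz gives `m₁² ≤ m₀ m₂`; Bogoliubov: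
equality, `C = 1`). [Feynman 1954 single-mode ansatz, as an inequality] A statement, not a fact. -/
def FeynmanSaturation : Prop :=
  CruxFrame fun C ρ n Ψ => ∀ m : Fin 3 → ℤ, m ≠ 0 →
    (((n : ℝ) + 1) * structureFactor n (sideLength ρ (n + 1)) Ψ m) *
        secondMoment (n + 1) (sideLength ρ (n + 1)) Ψ.ψ m ≤
      C * (((n : ℝ) + 1) ^ 2 * ‖waveVec (sideLength ρ (n + 1)) m‖ ^ 4)

/-- **SMB — second-moment (Puff–Hölder) bound** (typed fallback; shares its open input with the route's
crux `PuffFloor`): `m₂ ≤ C N ‖k‖³ √(‖k‖² + ρ)`. Intended proof: `m₂ ≤ √(m₁ M₃)`, f-sum `m₁ = N‖k‖²`,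
Puff's cubic moment `M₃ ≤ N‖k‖⁴(‖k‖² + Θρ)`. [Puff 1965; Stringari 1995 §2.3 (20)–(23)]
A statement, not a fact. -/
def SecondMomentBound : Prop :=
  CruxFrame fun C ρ n Ψ => ∀ m : Fin 3 → ℤ, m ≠ 0 →
    secondMoment (n + 1) (sideLength ρ (n + 1)) Ψ.ψ m ≤
      C * ((n : ℝ) + 1) * ‖waveVec (sideLength ρ (n + 1)) m‖ ^ 3 *
        Real.sqrt (‖waveVec (sideLength ρ (n + 1)) m‖ ^ 2 + ρ)

/-- **SFC — structure-factor ceiling** (typed fallback, density side): `S_m ≤ C‖k‖/√(‖k‖² + ρ)`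
("`S` is not larger than Feynman's"; via `m₀² ≤ m₁ m₋₁` a uniform static-response bound).
Bogoliubov: `S = ‖k‖/√(‖k‖²+16πρa)`. A statement, not a fact. -/
def StructureFactorCeiling : Prop :=
  CruxFrame fun C ρ n Ψ => ∀ m : Fin 3 → ℤ, m ≠ 0 →
    structureFactor n (sideLength ρ (n + 1)) Ψ m ≤
      C * ‖waveVec (sideLength ρ (n + 1)) m‖ / Real.sqrt (‖waveVec (sideLength ρ (n + 1)) m‖ ^ 2 + ρ)

/-- **The crux, restated over the named objects**: `CruxFrame (Π_m = N·ν_m·S_m ≤ C)`. Definitionally equal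
to `Theses.BECConjugateDomination.InfraredMinimumUncertainty` (its `let`s `L, g, ν, S` zeta-reduce to the
bodies of `sideLength`, `coherence`, `levyWeight`, `structureFactor`): see
`infraredMinimumUncertainty_iff_named`. A statement (the crux itself), not a fact. -/
def InfraredMinimumUncertaintyNamed : Prop :=
  CruxFrame fun C ρ n Ψ => ∀ m : Fin 3 → ℤ, m ≠ 0 →
    ((n : ℝ) + 1) * levyWeight n (sideLength ρ (n + 1)) Ψ m *
      structureFactor n (sideLength ρ (n + 1)) Ψ m ≤ C

/-- Certificate: the named restatement IS the crux `InfraredMinimumUncertainty` (by `Iff.rfl`). -/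
theorem infraredMinimumUncertainty_iff_named :
    InfraredMinimumUncertaintyNamed ↔ InfraredMinimumUncertainty :=
  Iff.rfl

/-! ## Small API for the gen-2 objects -/

/-- Coordinates of the wave vector: `k_c = 2π m_c / L`. -/
theorem waveVec_apply (L : ℝ) (m : Fin 3 → ℤ) (c : Fin 3) :
    waveVec L m c = 2 * Real.pi / L * (m c : ℝ) := by
  simp [waveVec, latticeVec]

/-- `latticeVec 1 m ≠ 0` for `m ≠ 0`. -/
theorem latticeVec_one_ne_zero {m : Fin 3 → ℤ} (hm : m ≠ 0) : latticeVec 1 m ≠ 0 := by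
  intro h
  apply hm
  funext k
  have := congrArg (fun v : Space => v k) h
  simpa [latticeVec] using this

/-- `‖k‖ > 0` for `m ≠ 0` and `L > 0`. -/
theorem norm_waveVec_pos {L : ℝ} (hL : 0 < L) {m : Fin 3 → ℤ} (hm : m ≠ 0) :
    0 < ‖waveVec L m‖ := by
  unfold waveVec
  rw [norm_smul]
  exact mul_pos (by rw [Real.norm_eq_abs, abs_of_pos (by positivity)]; positivity)
    (norm_pos_iff.mpr (latticeVec_one_ne_zero hm))

end Summit.AtomisticToContinuum.BoseEinsteinCondensation.Cruxes.InfraredMinimumUncertainty.FisherGaussianDensityMode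

end
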